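import Summits.Ventures.HSemireg.Pad4FirstOrderModelChecks
import Summits.Ventures.HSemireg.Pad4PhaseKernelCertificate

/-!
# Venture HSemireg — the seam between the PAD-4 first-order MODEL (rows 716 ∕ 731) and the PHASE-KERNEL CERTIFICATE (row 717)

HONEST FRAMING. PROVED bookkeeping (typer hodge-lit-semireg-typer g7, 2026-08-27). `Pad4FirstOrderModel.lean` (p505821, FILE A)
and gs-eng-2's `Pad4PhaseKernelCertificate.lean` (row 717, FILE B1) were filed STANDALONE («same constituent field names, no import
between the files»); the referees checked BY EYE (×2: lit-semireg-ref g14 ∕ g15, s4-ref g68) that FILE B1's effectivity rule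
`Pad4PhaseKernel.effectivity_rule` — «`c ℓ_ζ − c′ ℓ_{ζ′}` is positive semidefinite iff `c′ = 0 ∨ (ζ = ζ′ ∧ c′ ≤ c)`», the cell's
×2 reading of PAD4-THEOREM-L §5 (P0) — has the same right-hand side as the model's section-space rule
`Pad4FirstOrder.idxH0_nonempty_iff` (companion, row 731). This file makes that seam a KERNEL statement:
`idxH0_nonempty_iff_letterDiffPSD` — the model has an entry space `H⁰(Y − X) ≠ 0` iff `Y` and `X` lie in one layer and on
every factor FILE B1's psd test `letterDiffPSD` of the letter difference passes. So FILE B1's phase-kernel tables speak about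
the SAME effectivity predicate the model's (E1) systems use. Cross-layer pairs: the model gives them no coordinates at all
(`idxH0_eq_empty_of_layer_ne`, `idxH2_eq_empty_of_layer_ne` below; FAITHFULNESS (b)(i) of the model file), the geometric
reason being FILE B1's `Pad4PhaseKernel.layer_eigenvalue_sign` (a non-zero layer shift gives the block a negative eigenvalue —
PAD4-E7-TWIN §1 LEMMA L7 (LL′)), cited here by name, not re-proved. Nothing here proves `TheoremLZeta` (kernel-OPEN); nothing
is TIER 2; nothing here says HC ∕ HC_CM ∕ HC_AV holds; no fact, no definition, no instance, no notation. Typed ≠ proved ≠ endorsed.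
-/

namespace Summit.Ventures.HSemireg.Pad4FirstOrder
open Finset

/-- **THE SEAM (P0)**: the model's entry space `H⁰(Y − X)` is non-zero iff `Y`, `X` share the layer and, factor by factor,
FILE B1's positive-semidefiniteness test of the letter difference `c_Y ℓ_{ζ_Y} − c_X ℓ_{ζ_X}` passes
(`Pad4PhaseKernel.effectivity_rule`: `letterDiffPSD c z c' z' ↔ c' = 0 ∨ (z = z' ∧ c' ≤ c)`; model side `idxH0_nonempty_iff`). -/
theorem idxH0_nonempty_iff_letterDiffPSD (Y X : Constituent) :
    (idxH0 Y X).Nonempty ↔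
      Y.layer = X.layer ∧ ∀ g, Pad4PhaseKernel.letterDiffPSD (Y.charge g) (Y.phase g) (X.charge g) (X.phase g) = true := by
  rw [idxH0_nonempty_iff]
  refine and_congr_right fun _ => forall_congr' fun g => ?_
  rw [Pad4PhaseKernel.effectivity_rule]

/-- cross-layer pairs carry no sections in the model … -/
theorem idxH0_eq_empty_of_layer_ne (Y X : Constituent) (h : Y.layer ≠ X.layer) : idxH0 Y X = ∅ :=
  Finset.not_nonempty_iff_eq_empty.mp fun hne => h ((idxH0_nonempty_iff Y X).mp hne).1

/-- … and no unknowns: every factor is `dead`, so `H²(Y − X)` has no model coordinates (the geometric reason is FILE B1's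
`Pad4PhaseKernel.layer_eigenvalue_sign`: a non-zero layer shift gives every factor block a negative eigenvalue, so no Künneth
component of total degree `2` survives — PAD4-E7-TWIN §1 LEMMA L7 (LL′); the model file's FAITHFULNESS (b)(i)). -/
theorem idxH2_eq_empty_of_layer_ne (Y X : Constituent) (h : Y.layer ≠ X.layer) : idxH2 Y X = ∅ := by
  have hd : rel Y X 0 = Rel.dead := by unfold rel; rw [if_pos h]
  refine Finset.not_nonempty_iff_eq_empty.mp fun hne => ?_
  obtain ⟨q, _, hq⟩ := Finset.biUnion_nonempty.mp hne
  obtain ⟨o, ho⟩ := (Finset.image_nonempty.mp hq)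
  have := Fintype.mem_piFinset.mp ho 0
  rw [hd] at this
  revert this
  cases q 0 <;> simp [idx]

end Summit.Ventures.HSemireg.Pad4FirstOrder
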